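import Summits.ResolutionOfSingularities.ResolutionOfSingularities.Theses.RuledResidues
import Summits.ResolutionOfSingularities.ResolutionOfSingularities.Theorems.RuledResiduesNonRuledDivisorsStubTransportPlace
import Summits.ResolutionOfSingularities.ResolutionOfSingularities.Theorems.RuledResiduesNonRuledDivisorsStubTransportSingular
import Summits.ResolutionOfSingularities.ResolutionOfSingularities.Theorems.RuledResiduesNonRuledDivisorsStubTransportNonRuled
import Summits.ResolutionOfSingularities.ResolutionOfSingularities.Theorems.RuledResiduesNonRuledDivisorsStubContractingInjective
import Summits.ResolutionOfSingularities.ResolutionOfSingularities.Theorems.RuledResiduesNonRuledDivisorsStubModulusInjective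

/-!
# `RuledResidues.NonRuledDivisors` from ONE orbit germ (line `automorphism-orbit`, composition made unconditional in its stubs)

Crux stmt-ResolutionOfSingularities-18075 (`RuledResidues.NonRuledDivisors`, THE WITNESS of the refutation-shaped route
`RuledResidues`) asks for an affine model `R` of `K/k` (char `p`) with INFINITELY MANY divisorial places over `Sing R` whose
residue fields are not ruled over `k`.  The line `automorphism-orbit` (`Cruxes/NonRuledDivisors/Lines/automorphism_orbit.lean`)
reduces this to an ORBIT GERM: ONE such place `W` dominating a singular prime `P` of `R`, together with a ring automorphism
`τ` of `K`, semilinear over an automorphism `ι` of `k`, with `τ R ⊆ R`, `τ P ⊆ P`, and an injectivity certificate for the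
orbit `n ↦ W.comap τⁿ` — engine (A): `P ≠ 0` and `τ P ⊆ P²`, or engine (B): a `τ`-fixed `x` and a scalar `a` of infinite
`ι`-orbit with `x − a·1 ∈ 𝔪_W`.

This file records the reduction as a THEOREM of the tree: `nonRuledDivisors_of_orbitGerm : OrbitGerm → NonRuledDivisors`, with
the germ spelled out as the hypothesis (verbatim the registered stub `stub_orbitGerm`).  All transport and engine lemmas it
uses are landed: `stub_transportPlace` (p165696), `stub_transportSingular` (p165626), `stub_transportNonRuled` (p165673),
`stub_contractingInjective` (p165816), `stub_modulusInjective` (p165448).  What remains open is the germ itself — honestly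
at least crux-sized: with the route's kills (`RegularModelRuled`, `NonRuledCofinite`) any germ refutes resolution of
`Spec R`, so by Cossart–Piltant it needs `trdeg_k K ≥ 4` and is a counterexample to resolution in positive characteristic.

Proof: the orbit `f n = W.comap τⁿ` satisfies `f (n+1) = (f n).comap τ`; by induction every `f n` contains `k` and `R`, is
a DVR essentially of finite type over `k`, dominates `P` (transportPlace), is centred at a non-regular point of `Spec R`
(transportSingular, Serre) and has non-ruled residue field (transportNonRuled); the certificate makes `f` injective
(contractingInjective / modulusInjective); `Set.infinite_of_injective_forall_mem` concludes.
-/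

-- dupNamespace: the problem namespace legitimately repeats the summit name
set_option linter.dupNamespace false

namespace Summit.ResolutionOfSingularities.ResolutionOfSingularities.Theorems

open Summit.ResolutionOfSingularities.ResolutionOfSingularities.Theses.RuledResidues

/-- **The orbit reduction of the witness crux.**  If there is an ORBIT GERM — a prime `p`, a field `k` of characteristic
`p`, a field `K` with an affine model `R` (finitely generated `k`-subalgebra, `Frac R = K`), a prime `P` of `R` with `R_P`
not regular, a ring automorphism `τ` of `K` semilinear over an automorphism `ι` of `k` with `τ R ⊆ R`, `τ P ⊆ P`, ONE
valuation ring `W` of `K` dominating `P` that lies in the witness set of `NonRuledDivisors` (contains `k`, DVR, essentially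
of finite type over `k`, contains `R` with non-regular centre, residue field not ruled over `k`), and a certificate
(`P ≠ 0 ∧ τ P ⊆ P²`, or a `τ`-fixed `x` with `x − a·1 ∈ 𝔪_W` for a scalar `a` of infinite `ι`-orbit) — then
`RuledResidues.NonRuledDivisors` holds: the orbit `n ↦ W.comap τⁿ` is an infinite family of such places.
The hypothesis is verbatim the registered stub `stub_orbitGerm` of line `automorphism-orbit`. [folklore] -/
theorem nonRuledDivisors_of_orbitGerm : (∃ p : ℕ, p.Prime ∧ ∃ (k K : Type) (_ : Field k) (_ : CharP k p) (_ : Field K) (_ : Algebra k K), ∃ R : Subalgebra k K, R.FG ∧ IsFractionRing R K ∧ ∃ (P : Ideal R.toSubring) (_ : P.IsPrime), ¬ IsRegularLocalRing (Localization.AtPrime P) ∧ ∃ (τ : K ≃+* K) (ι : k ≃+* k), (∀ c : k, τ (algebraMap k K c) = algebraMap k K (ι c)) ∧ (∀ r : K, r ∈ R → τ r ∈ R) ∧ (∀ r : R.toSubring, r ∈ P → ∃ r' : R.toSubring, r' ∈ P ∧ (r' : K) = τ (r : K)) ∧ ∃ W : ValuationSubring K, (∀ r : R.toSubring, r ∈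 P → (r : K) ∈ W.nonunits) ∧ (∃ hk : (∀ c : k, algebraMap k K c ∈ W), IsDiscreteValuationRing W ∧ (∃ B : Subalgebra k K, B.FG ∧ B.toSubring ≤ W.toSubring ∧ ∀ x : K, x ∈ W → ∃ b s : K, b ∈ B ∧ s ∈ B ∧ s ∉ W.nonunits ∧ x * s = b) ∧ (∃ h : R.toSubring ≤ W.toSubring, ¬ IsRegularLocalRing (Localization.AtPrime (Ideal.comap (Subring.inclusion h) (IsLocalRing.maximalIdeal W)))) ∧ ¬ (∃ (L : Subfield (IsLocalRing.ResidueField W)) (t : IsLocalRing.ResidueField W), (∀ c : k, IsLocalRing.residue W ⟨algebraMap k K c, hk c⟩ ∈ L) ∧ (∀ f : Polynomial L, f ≠ 0 → Polynomial.eval₂ L.subtype t f ≠ 0) ∧ (∀ x : IsLocalRing.ResidueField W, ∃ f g : Polynomial L, Polynomial.eval₂ L.subtype t g ≠ 0 ∧ x * Polynomial.eval₂ L.subtype t g = Polynomial.eval₂ L.subtype t f))) ∧ ((P ≠ ⊥ ∧ ∀ r : R.toSubring, r ∈ P → ∃ r' : R.toSubring, r' ∈ P ^ 2 ∧ (r'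 : K) = τ (r : K)) ∨ (∃ (x : K) (a : k), τ x = x ∧ (∀ n : ℕ, 0 < n → (ι ^ n) a ≠ a) ∧ x - algebraMap k K a ∈ W.nonunits))) → Summit.ResolutionOfSingularities.ResolutionOfSingularities.Theses.RuledResidues.NonRuledDivisors := by
  intro hgerm
  obtain ⟨p, hp, k, K, instk, instc, instK, instA, R, hRfg, hfrac, P, instP, hsing, τ, ι, hsemi, hR, hP,
    W, hdom, hW, hcert⟩ := hgerm
  -- the orbit
  let f : ℕ → ValuationSubring K := fun n => W.comap ((τ ^ n : K ≃+* K) : K →+* K)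
  have hf0 : f 0 = W := by
    ext y
    simp [f, ValuationSubring.mem_comap]
  have hfsucc : ∀ n : ℕ, f (n + 1) = (f n).comap (τ : K →+* K) := by
    intro n
    ext y
    simp only [f, ValuationSubring.mem_comap]
    rfl
  -- injectivity of the orbit from the certificate
  have hinj : Function.Injective f := by
    rcases hcert with ⟨hPne, hcon⟩ | ⟨x, a, hx, ha, hxa⟩
    · obtain ⟨hk, hdvr, hft, ⟨hle, _⟩, hnr⟩ := hW
      exact stub_contractingInjective K R.toSubring P hPne τ hR hcon W hdvr hle hdom
    · obtain ⟨hk, _⟩ := hW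
      exact stub_modulusInjective k K τ ι hsemi W hk x a hx ha hxa
  -- every member of the orbit is in the witness set (and dominates `P`)
  have hall : ∀ n : ℕ, (∃ hk : (∀ c : k, algebraMap k K c ∈ (f n)), IsDiscreteValuationRing (f n) ∧ (∃ B : Subalgebra k K, B.FG ∧ B.toSubring ≤ (f n).toSubring ∧ ∀ x : K, x ∈ (f n) → ∃ b s : K, b ∈ B ∧ s ∈ B ∧ s ∉ (f n).nonunits ∧ x * s = b) ∧ (∃ h : R.toSubring ≤ (f n).toSubring, ¬ IsRegularLocalRing (Localization.AtPrime (Ideal.comap (Subring.inclusion h) (IsLocalRing.maximalIdeal (f n))))) ∧ ¬ (∃ (L : Subfield (IsLocalRing.ResidueField (f n))) (t : IsLocalRing.ResidueField (f n)), (∀ c : k, IsLocalRing.residue (f n) ⟨algebraMap k K c, hk c⟩ ∈ L) ∧ (∀ f : Polynomial L, f ≠ 0 → Polynomial.eval₂ L.subtype t f ≠ 0) ∧ (∀ x : IsLocalRing.ResidueField (f n), ∃ f g : Polynomial L, Polynomial.eval₂ L.subtype t g ≠ 0 ∧ x * Polynomial.eval₂ L.subtype t g = Polynomial.eval₂ L.subtype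 t f))) ∧ (∀ r : R.toSubring, r ∈ P → (r : K) ∈ (f n).nonunits) := by
    intro n
    induction n with
    | zero =>
      rw [hf0]
      exact ⟨hW, hdom⟩
    | succ n ih =>
      obtain ⟨⟨hk, hdvr, hft, ⟨hle, _⟩, hnr⟩, hdomn⟩ := ih
      obtain ⟨hk', hdvr', hft', hle', hdom'⟩ :=
        stub_transportPlace k K R P τ ι hsemi hR hP (f n) (f (n + 1)) (hfsucc n) hk hdvr hft hle hdomn
      have hsing' := stub_transportSingular K R.toSubring P hsing (f (n + 1)) hle' hdom'
      have hnr' := stub_transportNonRuled k K τ ι hsemi (f n) (f (n + 1)) (hfsucc n) hk hk' hnr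
      exact ⟨⟨hk', hdvr', hft', ⟨hle', hsing'⟩, hnr'⟩, hdom'⟩
  refine ⟨p, hp, k, K, instk, instc, instK, instA, R, hRfg, hfrac, ?_⟩
  exact Set.infinite_of_injective_forall_mem hinj (fun n => (hall n).1)

end Summit.ResolutionOfSingularities.ResolutionOfSingularities.Theorems
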